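import Literature.IUT.HodgeArakelov.CohomologyLimitKummerRestrict
import Literature.IUT.HodgeArakelov.CohomologyLimitKummerGalois
import Literature.IUT.HodgeArakelov.EtaleThetaDataOfSettingGaloisUnits
import Summits.ABC.IUTFork.LanaEtaAlgorithm
import HarnessLib

/-!
# L-LANA objects XI sexies: the `η`-algorithm signature over the GENUINE cohomology limit `lim_K H¹(· ⊓ K, A')`

Record-only file (D-0012; seat abc-iut-c312-4 gen 5, L-LANA level, plan/LLANA-SPEC N14 Steps 2–3, 5, 6 and N13
"continuous comparison"); TAKES NO SIDE on [IUTchIII] Cor. 3.12. It REPLACES gen 3's bounced `LanaEtaEtTh.lean`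
(p415218; review: its `sync` compared a fixed-level continuous `H¹(D_x ∩ Π^tp_Ÿ, Δ_Θ)` with a colimit of discrete
`H¹`'s of `D_x` — different group, different level, so only degenerately inhabited). HERE every cohomology group of
LANA's Fig. 3 is the SAME object: layer L6's genuine continuous-cohomology limit
`h1Lim φ A' H ⊥ = lim_K H¹(H ⊓ K, A')` over the finite-index open `K ≤ Π` (abc-iut-L6-t1
`CohomologySystemOfContH1`, built on layer L2's `ContH1`), LANA §6.1 p. 32 "`∞H^i(G, A) := lim_J H^i(G|_J, A)`";
restriction is L6's `h1LimRestrict` (Cor. 1.12 (ii) shape) and the Kummer maps are abc-iut-w4-d007's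
`h1LimKummer c` INTO THAT LIMIT along a change of coefficient cyclotome `c : Λ(A) → A'` (L2 `CyclotomeCoefficients`:
continuous, `Π`-equivariant). LANA §6.2 (c)–(g) pp. 34–36 / Fig. 3: "(6-1) `θ(Π_v) ⊆ H¹(Π_{v,Ÿ}, (l·Δ_Θ)(Π_v))`",
"`M^Θ_{v,∞} := O^×_v(Π_v) · ∞θ(Π_v)`", "(6-3) … `∞H¹(Π_{v,Ÿ}, (l·Δ_Θ)(Π_v)) → ∏_t ∞H¹(D_t, (l·Δ_Θ)(Π_v))`",
"`ι_t : C_v ⥲ Λ_{v,t}` … `κ_t : O^▷_{v,t} → ∞H¹(D_t, Λ_{v,t})` is the local Kummer map … `φ_{v,t} = (ι_t)_*⁻¹ ∘ κ_t`".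

`EtaLimSide φ A' H A` (data) and `EtaLimSide.toEtaSteps` fill the gen-0 signature `EtaSteps` with:
* `H1Y := ∞H¹(H, A') = lim_K H¹(H ⊓ K, A')` — REAL (`H = Π_{v,Ÿ}`, `A' = (l·Δ_Θ)(Π_v)`);
* `H1D t := ∞H¹(D_t, A') = lim_K H¹(D_t ⊓ K, A')` for subgroups `D_t ≤ H` — REAL, SAME machinery;
* `res t :=` L6's `h1LimRestrict` — REAL restriction of the limits (6-3);
* `O t := O` a submonoid of the `Π`-module `A` (`O^▷_v ⊆ K̄_v^×`), `H1DΛ t := H1D t`, `sync := id`, and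
  `kappa t := h1LimKummerOn … (D t) c O` — the REAL Kummer map of `O` into `∞H¹(D_t, A')` WITH THE COEFFICIENT
  CHANGE `c` BUILT IN: LANA's `φ_{v,t} = (ι_t)_*⁻¹ ∘ κ_t` computed at cocycle level (the Kummer cocycle with values
  in `Λ(A)` pushed through `c`), so the cyclotomic synchronization `ι_t` is PRESENT — as the datum `c` of the right
  type (an equivariant continuous `Λ(A) → A'`; at the model "the" cyclotomic rigidity isomorphism
  `Λ(ℚ̄_pˣ) = Ẑ(1) ⥲ l·Δ_Θ`, CONSTRUCTED by abc-iut-w4-d007 gen 3 from L2's cyclotome tower,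
  `EtaleThetaDataOfSettingKummerTower.exists_cyclotomeCoefficients_of_cyclotomeTower`) — not as an unrelated
  abstract isomorphism between two different groups;
* `unitsEt := κ_H(O^×)` — REAL: "an étale-like copy of `O^×_v`" IS the Kummer image of the units in `∞H¹(H, A')`;
* `thetaInf :=` the submonoid generated by LANA's `∞θ := {x | some positive power of x coincides up to torsion
  with an element of θ}` — DEFINED (§6.2 (d); [IUTchII] Prop. 1.4), no longer an abstract slot;
* `thetaClasses`, the mono-theta side (`MFrob`, `kum`, `rgd`), the labels `t ↦ D_t` and `qPow` remain data.

PROVED (no hypothesis unless named): `res_kappaH` — **`res_t ∘ κ_H = κ_{D_t}`** (L6 `h1LimRestrict_h1LimKummer`);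
hence `res_unit_mem_mrange_kappa` — **the `O^×(Π_v)`-part of LANA's Containment HOLDS outright** (units restrict
into `κ_t(O^▷)`); `thetaClasses_subset_thetaInfSet` (`θ ⊆ ∞θ`); `phiProd_injective_of` / `containment_iff_factors_of`
/ `factorisation_unique_of` from injectivity of the `κ_{D_t}`; `containment_of_eval` — **Containment ⟸
`KummerImageEq` ∧ (every element of `∞θ` restricts into `κ_t(O^▷)` at every `t`)** — the second conjunct is the
[IUTchII] Cor. 2.5 / [EtTh] Prop. 1.4 (iii)-type Galois-evaluation law, the ONE remaining input; and, for a
`Π` acting on `k̄ˣ` through a continuous `ε : Π → G_k` (abc-iut-L4 `MLFClosure`; tempered groups included),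
`phiProd_injective_of_aug` — **`φ_v` injective with NO module hypothesis** as soon as each `ε(D_t) ≤ G_k` has
finite index and `c` is bijective (L6 `h1LimKummer_injective_of_aug`).
HONEST SCOPE. (i) `∞H¹` here is the colimit over finite-index OPEN `K ≤ Π` of CONTINUOUS `H¹(· ⊓ K, A')` — LANA's
"`J` … finite index open" exactly; (ii) the action of `Π` on the limit and LANA's `Π_v`-equivariance are L6's
`h1LimConj*` (not repeated); (iii) no judgement on whether the evaluation law holds at the model — layer L6/L2 own
[IUTchII] §2 / [EtTh] Prop. 1.4 (iii) (anchored form). [cite: LANA2026Report, §6.1 p. 32, §6.2 pp. 33–36, §9.1 pp. 44–45]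
[cite: Mochizuki2012, Prop 1.4 p.27] NOT here: any judgement.
-/

noncomputable section

namespace Summit.ABC
namespace IUTFork

open Literature.AnabelianGeometry.EtaleTheta
open Literature.IUT.HodgeArakelov
open Literature.IUT.HodgeArakelov.CohomologySystemOfContH1

/-! ## 1. The data: Fig. 3 over the cohomology limit -/

/-- **Fig. 3 over the genuine limit `lim_K H¹(· ⊓ K, A')`.** Ambient data: a topological group `Π` (`P`),
coefficients `A' ≤ G'` abelian normal with `Π` acting by conjugation through `φ` (`(l·Δ_Θ)(Π_v)`), the subgroup
`H = Π_{v,Ÿ}`, a discrete rootable `Π`-module `A` (`K̄_v^×`). Fields: the discreteness of `A` (open finite-index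
stabilisers), the cyclotomic synchronization datum `c : Λ(A) → A'`, `θ(Π_v)`, `O^× ≤ O^▷ ≤ A`, the mono-theta side,
the labels with their decomposition groups `D_t ≤ H`, the theta values. [cite: LANA2026Report, §6.2 pp. 33–36] -/
structure EtaLimSide {P : TopGroup.{0}} {G' : Type} [Group G'] [TopologicalSpace G'] [IsTopologicalGroup G']
    (φ : P →* G') (A' : Subgroup G') [A'.Normal] [IsMulCommutative A'] (H : Subgroup P)
    (A : Type) [CommGroup A] [MulDistribMulAction P A] [TopologicalSpace A] [RootableBy A ℕ] : Type 1 where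
  /-- stabilisers in `Π` of elements of `A` are open (`A` discrete; §6.1 "(open) subgroups") -/
  hA : ∀ b : A, IsOpen (MulAction.stabilizer P b : Set P)
  /-- … and of finite index (§6.1 (c) "`M = ⋃_H M^H`" over finite-index open `H`) -/
  hfi : ∀ b : A, (MulAction.stabilizer P b).FiniteIndex
  /-- the cyclotomic synchronization `ι_t : C_v ⥲ Λ_{v,t}` read as a change of coefficient cyclotome
  `Λ(A) → A'` (continuous, `Π`-equivariant; §6.2 (g), [IUTchII] Cor. 1.11) -/
  c : CyclotomeCoefficients φ A' A
  /-- `θ(Π_v) ⊆ ∞H¹(Π_{v,Ÿ}, (l·Δ_Θ)(Π_v))` (6-1) -/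
  thetaClasses : Set (Multiplicative (h1Lim φ A' H ⊥))
  /-- `O^▷_v ⊆ K̄_v^×`, the integral elements (§0.4 (b)) -/
  O : Submonoid A
  /-- `O^×_v` -/
  units : Subgroup A
  /-- `O^×_v ⊆ O^▷_v` -/
  units_le : units.toSubmonoid ≤ O
  /-- `M^{Θ,Frob}_{v,∞}` (Step 4) -/
  MFrob : Type
  [instMFrob : CommMonoid MFrob]
  /-- `∞H¹(Π_{v,Ÿ}, Λ^{ext}_{Θ,v})` -/
  H1Yext : Type
  [instH1Yext : CommGroup H1Yext]
  /-- the Kummer map of the theta monoid -/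
  kum : MFrob →* H1Yext
  /-- the isomorphism induced by `Θ-Λ-rgd` (6-2), onto the REAL `∞H¹(Π_{v,Ÿ}, A')` -/
  rgd : H1Yext ≃* Multiplicative (h1Lim φ A' H ⊥)
  /-- the labels `t` (Step 5) -/
  T : Type
  /-- the decomposition group `D_t ⊆ Π_{v,Ÿ}` under the label `t` (§6.2 (f)) -/
  D : T → Subgroup P
  /-- `D_t ≤ Π_{v,Ÿ}` -/
  D_le : ∀ t, D t ≤ H
  /-- the theta values `q_v^{t²} ∈ O^▷_v` -/
  qPow : T → O

attribute [instance] EtaLimSide.instMFrob EtaLimSide.instH1Yext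

namespace EtaLimSide

variable {P : TopGroup.{0}} {G' : Type} [Group G'] [TopologicalSpace G'] [IsTopologicalGroup G']
  {φ : P →* G'} {A' : Subgroup G'} [A'.Normal] [IsMulCommutative A'] {H : Subgroup P}
  {A : Type} [CommGroup A] [MulDistribMulAction P A] [TopologicalSpace A] [RootableBy A ℕ]
  (S : EtaLimSide φ A' H A)

/-- **LANA's `∞θ(Π_v)` DEFINED** (§6.2 (d): "the elements of the direct limit … for which some positive multiple
coincides up to torsion with an element of `θ(Π_v)`"; [IUTchII] Prop. 1.4), multiplicatively: `x ∈ ∞θ` iff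
`x ^ n / θ₀` has finite order for some `n > 0`, `θ₀ ∈ θ`. [cite: LANA2026Report, §6.2 (d) p. 34]
[cite: Mochizuki2012, Prop 1.4 p.27] -/
def thetaInfSet : Set (Multiplicative (h1Lim φ A' H ⊥)) :=
  {x | ∃ n : ℕ, 0 < n ∧ ∃ t ∈ S.thetaClasses, IsOfFinOrder (x ^ n / t)}

/-- `θ(Π_v) ⊆ ∞θ(Π_v)` (`n = 1`, `θ₀ = x`: `x / x = 1` has finite order). [cite: LANA2026Report, §6.2 (d) p. 34] -/
theorem thetaClasses_subset_thetaInfSet : S.thetaClasses ⊆ S.thetaInfSet := fun x hx =>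
  ⟨1, Nat.one_pos, x, hx, by rw [pow_one, div_self']; exact IsOfFinOrder.one⟩

/-- **The `H`-level Kummer map `κ_H : A → ∞H¹(H, A')`** along `c` (L6 `h1LimKummer`; "an étale-like copy of
`O^×_v`" is its image of the units). [cite: LANA2026Report, §6.2 (d) p. 34] -/
abbrev kappaH : A →* Multiplicative (h1Lim φ A' H ⊥) := h1LimKummer φ A' H S.c S.hA S.hfi

/-- **The local Kummer map `κ_{D_t} : A → ∞H¹(D_t, A')`** along `c` (L6 `h1LimKummer` at `D_t`).
[cite: LANA2026Report, §6.2 (g) p. 35] -/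
abbrev kappaD (t : S.T) : A →* Multiplicative (h1Lim φ A' (S.D t) ⊥) := h1LimKummer φ A' (S.D t) S.c S.hA S.hfi

/-- **`EtaSteps` over the genuine limit** (module docstring, list of slots). [cite: LANA2026Report, §6.2 pp. 33–36] -/
def toEtaSteps : EtaSteps where
  H1Y := Multiplicative (h1Lim φ A' H ⊥)
  thetaClasses := S.thetaClasses
  thetaInf := Submonoid.closure S.thetaInfSet
  unitsEt := S.units.toSubmonoid.map S.kappaH
  thetaClasses_subset := S.thetaClasses_subset_thetaInfSet.trans Submonoid.subset_closure
  MFrob := S.MFrob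
  H1Yext := S.H1Yext
  kum := S.kum
  rgd := S.rgd
  T := S.T
  H1D t := Multiplicative (h1Lim φ A' (S.D t) ⊥)
  res t := AddMonoidHom.toMultiplicative (h1LimRestrict φ A' (S.D_le t) ⊥)
  O _ := S.O
  H1DΛ t := Multiplicative (h1Lim φ A' (S.D t) ⊥)
  kappa t := h1LimKummerOn φ A' (S.D t) S.c S.hA S.hfi S.O
  sync _ := MulEquiv.refl _
  qPow := S.qPow

/-! ## 2. What the real slots give -/

/-- Step 5 is REAL: `res_t` IS L6's restriction of the limits `∞H¹(H, A') → ∞H¹(D_t, A')`.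
[cite: LANA2026Report, §6.2 (f) p. 35] -/
theorem toEtaSteps_res_apply (t : S.T) (x : Multiplicative (h1Lim φ A' H ⊥)) :
    S.toEtaSteps.res t x = Multiplicative.ofAdd (h1LimRestrict φ A' (S.D_le t) ⊥ (Multiplicative.toAdd x)) := rfl

/-- Step 6 is REAL: `φ_{v,t}` IS the Kummer map of `O^▷` into `∞H¹(D_t, A')` along `c` (`sync = id`).
[cite: LANA2026Report, §6.2 (g) p. 35] -/
theorem toEtaSteps_phi_apply (t : S.T) (a : S.O) : S.toEtaSteps.phi t a = S.kappaD t (a : A) := rfl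

/-- `ψ_v` at `t` IS restriction of `rgd ∘ kum`. [cite: LANA2026Report, §6.2 (f) p. 36] -/
theorem toEtaSteps_psi_apply (m : S.MFrob) (t : S.T) :
    S.toEtaSteps.psi m t = S.toEtaSteps.res t (S.rgd (S.kum m)) := rfl

/-- Step 3's `O^×(Π_v)` is REAL: the Kummer image of the units in `∞H¹(H, A')`. [cite: LANA2026Report, §6.2 (d) p. 34] -/
theorem toEtaSteps_unitsEt : S.toEtaSteps.unitsEt = S.units.toSubmonoid.map S.kappaH := rfl

/-- **`res_t ∘ κ_H = κ_{D_t}`** — restriction to `D_t` of the `Π_{v,Ÿ}`-level Kummer class of `b` is its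
`D_t`-level Kummer class (L6 `h1LimRestrict_h1LimKummer`; §6.1 p. 32 "this restriction operation can be
interpreted as the Kummer-theoretic analogue of evaluation"). [cite: LANA2026Report, §6.1 p. 32]
[cite: Mochizuki2012, Cor 1.12 p.56] -/
theorem res_kappaH (t : S.T) (b : A) : S.toEtaSteps.res t (S.kappaH b) = S.kappaD t b :=
  congrArg Multiplicative.ofAdd (h1LimRestrict_h1LimKummer φ A' (S.D_le t) S.c S.hA S.hfi b)

/-- **The `O^×(Π_v)`-part of the Containment HOLDS outright**: every element of the étale-like units restricts
at every `t` into `κ_t(O^▷_{v,t})` (`O^× ⊆ O^▷`). [cite: LANA2026Report, §6.2 (d) p. 34, §6.2 (g) p. 36] -/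
theorem res_unit_mem_mrange_kappa (t : S.T) {x : Multiplicative (h1Lim φ A' H ⊥)} (hx : x ∈ S.toEtaSteps.unitsEt) :
    S.toEtaSteps.res t x ∈ MonoidHom.mrange (S.toEtaSteps.kappa t) := by
  obtain ⟨u, hu, rfl⟩ := hx
  exact ⟨⟨u, S.units_le hu⟩, (S.res_kappaH t u).symm⟩

/-! ## 3. Injectivity of `φ_v` and Containment ⟺ Factors -/

/-- `φ_v := ∏_t φ_{v,t}` is injective as soon as every `κ_{D_t}` is injective on `A`.
[cite: LANA2026Report, §6.2 (g) pp. 35–36] -/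
theorem phiProd_injective_of (hinj : ∀ t, Function.Injective (S.kappaD t)) :
    Function.Injective S.toEtaSteps.phiProd :=
  S.toEtaSteps.phiProd_injective fun t => h1LimKummerOn_injective φ A' (S.D t) S.c S.hA S.hfi S.O (hinj t)

/-- **Containment ⟺ Factors** when the `κ_{D_t}` are injective. [cite: LANA2026Report, §6.2 (g) p. 36, §9.1 (f) p. 45] -/
theorem containment_iff_factors_of (hinj : ∀ t, Function.Injective (S.kappaD t)) :
    S.toEtaSteps.Containment ↔ S.toEtaSteps.Factors :=
  S.toEtaSteps.containment_iff_factors fun t => h1LimKummerOn_injective φ A' (S.D t) S.c S.hA S.hfi S.O (hinj t)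

/-- … with a unique factorisation. [cite: LANA2026Report, §9.1 (f) p. 45] -/
theorem factorisation_unique_of (hinj : ∀ t, Function.Injective (S.kappaD t))
    (lam lam' : S.toEtaSteps.MFrob →* ∀ t, S.toEtaSteps.O t) (h : S.toEtaSteps.phiProd.comp lam = S.toEtaSteps.psi)
    (h' : S.toEtaSteps.phiProd.comp lam' = S.toEtaSteps.psi) : lam = lam' :=
  S.toEtaSteps.factorisation_unique
    (fun t => h1LimKummerOn_injective φ A' (S.D t) S.c S.hA S.hfi S.O (hinj t)) lam lam' h h'

/-! ## 4. Containment from the Galois-evaluation law on `∞θ` -/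

/-- If every element of `∞θ` restricts into `κ_t(O^▷)`, so does every element of the submonoid it generates
(`κ_t(O^▷)` is a submonoid and `res_t` a homomorphism). [cite: LANA2026Report, §6.2 (g) p. 36] -/
theorem thetaInf_le_comap (t : S.T)
    (hθ : ∀ x ∈ S.thetaInfSet, S.toEtaSteps.res t x ∈ MonoidHom.mrange (S.toEtaSteps.kappa t)) :
    S.toEtaSteps.thetaInf ≤ (MonoidHom.mrange (S.toEtaSteps.kappa t)).comap (S.toEtaSteps.res t) :=
  Submonoid.closure_le.mpr fun x hx => hθ x hx

/-- **The whole étale-like theta monoid `M^Θ = O^×(Π_v) · ⟨∞θ(Π_v)⟩` restricts into `κ_t(O^▷)`** granted the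
evaluation law on `∞θ` (the units part is a theorem). [cite: LANA2026Report, §6.2 (d) p. 34, §6.2 (g) p. 36] -/
theorem thetaMonoidEt_le_comap (t : S.T)
    (hθ : ∀ x ∈ S.thetaInfSet, S.toEtaSteps.res t x ∈ MonoidHom.mrange (S.toEtaSteps.kappa t)) :
    S.toEtaSteps.thetaMonoidEt ≤ (MonoidHom.mrange (S.toEtaSteps.kappa t)).comap (S.toEtaSteps.res t) :=
  sup_le (fun _ hx => S.res_unit_mem_mrange_kappa t hx) (S.thetaInf_le_comap t hθ)

/-- **LANA's CONTAINMENT over the genuine limit from the evaluation law**: if the Frobenioid-theoretic theta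
monoid has Kummer image `M^Θ` (p. 34 link `KummerImageEq`) and every element of `∞θ(Π_v)` restricts at every
`D_t` to the Kummer class of an element of `O^▷` ([IUTchII] Cor. 2.5 / [EtTh] Prop. 1.4 (iii) shape — the ONE
remaining input), then "the image of `ψ_v` … is contained in the image of `φ_v`" (p. 36).
[cite: LANA2026Report, §6.2 (g) p. 36] [cite: Mochizuki2012, Cor 2.5 p.71] -/
theorem containment_of_eval (hK : S.toEtaSteps.KummerImageEq)
    (hθ : ∀ t, ∀ x ∈ S.thetaInfSet, S.toEtaSteps.res t x ∈ MonoidHom.mrange (S.toEtaSteps.kappa t)) :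
    S.toEtaSteps.Containment := by
  rintro _ ⟨m, rfl⟩
  have hm : S.rgd (S.kum m) ∈ S.toEtaSteps.thetaMonoidEt := S.toEtaSteps.rgd_kum_mem_thetaMonoidEt hK m
  have hcomp : ∀ t, ∃ o : S.O, S.toEtaSteps.kappa t o = S.toEtaSteps.res t (S.rgd (S.kum m)) :=
    fun t => S.thetaMonoidEt_le_comap t (hθ t) hm
  choose o ho using hcomp
  refine ⟨o, funext fun t => ?_⟩
  rw [EtaSteps.phiProd_apply, EtaSteps.phi_apply, toEtaSteps_psi_apply, ← ho]
  rfl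

/-- … and then the §9.1 (f) factorisation EXISTS and is unique, if the `κ_{D_t}` are injective.
[cite: LANA2026Report, §9.1 (f) p. 45] -/
theorem factors_of_eval (hinj : ∀ t, Function.Injective (S.kappaD t)) (hK : S.toEtaSteps.KummerImageEq)
    (hθ : ∀ t, ∀ x ∈ S.thetaInfSet, S.toEtaSteps.res t x ∈ MonoidHom.mrange (S.toEtaSteps.kappa t)) :
    S.toEtaSteps.Factors :=
  (S.containment_iff_factors_of hinj).mp (S.containment_of_eval hK hθ)

end EtaLimSide

/-! ## 5. `φ_v` injective with NO module hypothesis for `Π` acting on `k̄ˣ` through `ε : Π → G_k` -/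

section Aug

open Literature.AnabelianGeometry.AbsoluteAnabelian

variable (C : MLFClosure.{0}) {Γ : Type} [Group Γ] [TopologicalSpace Γ] [IsTopologicalGroup Γ]
  [MulDistribMulAction Γ (C.K)ˣ] (aug : Γ →* (C.K ≃ₐ[C.k] C.K))
  (haug : ∀ (g : Γ) (u : (C.K)ˣ), ((g • u : (C.K)ˣ) : C.K) = aug g (u : C.K))
  {G' : Type} [Group G'] [TopologicalSpace G'] [IsTopologicalGroup G']
  {φ : (TopGroup.of Γ) →* G'} {A' : Subgroup G'} [A'.Normal] [IsMulCommutative A']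
  {H : Subgroup (TopGroup.of Γ)} [TopologicalSpace (C.K)ˣ]

include haug in
/-- **`κ_{D_t}` injective for a topological group acting on `k̄ˣ` through a continuous `ε : Π → G_k`** (abc-iut-L4
`MLFClosure`; the tempered `Π^tp_X ↠ G_K ≤ G_{ℚ_p}` included, `[G_{ℚ_p} : G_K] < ∞`): as soon as `ε(D_t) ≤ G_k` has
finite index (e.g. `ε(D_t)` open) and the synchronization `c` is bijective, with NO hypothesis on the module
(L6 `h1LimKummer_injective_of_aug`: fixed points of `D_t ⊓ K` lie in a finite `k′/k`, where `⋂ₙ (k′ˣ)ⁿ = 1`).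
[cite: LANA2026Report, §6.2 (g) pp. 35–36] [cite: Mochizuki2012, Prop 3.1 (ii) p.88] -/
theorem EtaLimSide.kappaD_injective_of_aug (S : EtaLimSide φ A' H (C.K)ˣ) (hcont : Continuous aug)
    (hfin : ∀ t, (Subgroup.map aug (S.D t)).FiniteIndex) (hc : Function.Bijective S.c.hom) (t : S.T) :
    Function.Injective (S.kappaD t) := by
  haveI := hfin t
  exact h1LimKummer_injective_of_aug C aug haug φ A' (S.D t) S.c hcont hc

include haug in
/-- Hence **`φ_v` injective, Containment ⟺ Factors, unique factorisation — NO module hypothesis** in that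
situation. [cite: LANA2026Report, §6.2 (g) p. 36, §9.1 (f) p. 45] -/
theorem EtaLimSide.phiProd_injective_of_aug (S : EtaLimSide φ A' H (C.K)ˣ) (hcont : Continuous aug)
    (hfin : ∀ t, (Subgroup.map aug (S.D t)).FiniteIndex) (hc : Function.Bijective S.c.hom) :
    Function.Injective S.toEtaSteps.phiProd :=
  S.phiProd_injective_of (S.kappaD_injective_of_aug C aug haug hcont hfin hc)

include haug in
/-- **Containment ⟺ Factors** in that situation. [cite: LANA2026Report, §6.2 (g) p. 36, §9.1 (f) p. 45] -/
theorem EtaLimSide.containment_iff_factors_of_aug (S : EtaLimSide φ A' H (C.K)ˣ) (hcont : Continuous aug)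
    (hfin : ∀ t, (Subgroup.map aug (S.D t)).FiniteIndex) (hc : Function.Bijective S.c.hom) :
    S.toEtaSteps.Containment ↔ S.toEtaSteps.Factors :=
  S.containment_iff_factors_of (S.kappaD_injective_of_aug C aug haug hcont hfin hc)

end Aug

/-! ## 6. Non-vacuity over the GENUINE group: the [IUTchII] §1 model `Π = Π^tp_X̲̲` of layer L6 -/

section Model

open Literature.IUT.HodgeArakelov.EtaleThetaDataOfSetting

variable {p : ℕ} [Fact p.Prime] {D : ThetaSetting p} {E : D.EtaleThetaData} {l : ℕ} (C : E.DoubleUnderline l)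
  [TopologicalSpace (PadicAlgCl p)ˣ]

/-- **The data are instantiated by layer L6's model** `Π := Π^tp_X̲̲` (`Pi C`), `Π_{v,Ÿ} := Π^tp_Ÿ̲̲` (`PiYdd C`),
`A' := l·Δ_Θ`, `A := ℚ̄_pˣ` with the Galois action through `ε` (abc-iut-w4-d007 `unitsAction`,
`isOpen_stabilizer_units`, `finiteIndex_stabilizer_units`), for ANY synchronization datum `c : Λ(ℚ̄_pˣ) → l·Δ_Θ`
(CONSTRUCTED bijective ones exist: `EtaleThetaDataOfSettingKummerTower.exists_cyclotomeCoefficients_of_cyclotomeTower`),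
theta classes `θ`, integral structure `O^× ≤ O^▷ ≤ ℚ̄_pˣ` and theta value `q`. The mono-theta side is filled
trivially and the single label carries `D_t := Π^tp_Ÿ̲̲` itself — a NON-VACUITY witness for the real slots (the
genuine labels' decomposition groups are abc-iut-L6's [IUTchII] §2 data), not a model of Step 4/7.
[cite: LANA2026Report, §6.2 pp. 33–36] [cite: Mochizuki2012, Prop 3.1 (ii) p.88] -/
def EtaLimSide.ofDoubleUnderline (c : CyclotomeCoefficients (phi C) (D.lDeltaTheta l) (PadicAlgCl p)ˣ)
    (θ : Set (Multiplicative (h1Lim (phi C) (D.lDeltaTheta l) (PiYdd C) ⊥))) (O : Submonoid (PadicAlgCl p)ˣ)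
    (U : Subgroup (PadicAlgCl p)ˣ) (hU : U.toSubmonoid ≤ O) (q : O) :
    EtaLimSide (phi C) (D.lDeltaTheta l) (PiYdd C) (PadicAlgCl p)ˣ where
  hA := isOpen_stabilizer_units C
  hfi := finiteIndex_stabilizer_units C
  c := c
  thetaClasses := θ
  O := O
  units := U
  units_le := hU
  MFrob := PUnit
  H1Yext := Multiplicative (h1Lim (phi C) (D.lDeltaTheta l) (PiYdd C) ⊥)
  kum := 1
  rgd := MulEquiv.refl _
  T := PUnit
  D _ := PiYdd C
  D_le _ := le_rfl
  qPow _ := q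

/-- At the model, with a BIJECTIVE synchronization `c`, **`φ_v` is injective with no further hypothesis**
(`ε(Π^tp_Ÿ̲̲) = G_K` has finite index in `G_{ℚ_p}`: abc-iut-w4-d007 `h1LimKummer_injective_of_coeff`).
[cite: LANA2026Report, §6.2 (g) pp. 35–36] [cite: Mochizuki2012, Prop 3.1 (ii) p.88] -/
theorem EtaLimSide.ofDoubleUnderline_phiProd_injective
    (c : CyclotomeCoefficients (phi C) (D.lDeltaTheta l) (PadicAlgCl p)ˣ) (hc : Function.Bijective c.hom)
    (θ : Set (Multiplicative (h1Lim (phi C) (D.lDeltaTheta l) (PiYdd C) ⊥))) (O : Submonoid (PadicAlgCl p)ˣ)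
    (U : Subgroup (PadicAlgCl p)ˣ) (hU : U.toSubmonoid ≤ O) (q : O) :
    Function.Injective (EtaLimSide.ofDoubleUnderline C c θ O U hU q).toEtaSteps.phiProd :=
  (EtaLimSide.ofDoubleUnderline C c θ O U hU q).phiProd_injective_of fun _ =>
    h1LimKummer_injective_of_coeff C (phi C) (D.lDeltaTheta l) c (PiYdd C) hc

/-- … hence Containment ⟺ Factors there. [cite: LANA2026Report, §6.2 (g) p. 36, §9.1 (f) p. 45] -/
theorem EtaLimSide.ofDoubleUnderline_containment_iff_factors
    (c : CyclotomeCoefficients (phi C) (D.lDeltaTheta l) (PadicAlgCl p)ˣ) (hc : Function.Bijective c.hom)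
    (θ : Set (Multiplicative (h1Lim (phi C) (D.lDeltaTheta l) (PiYdd C) ⊥))) (O : Submonoid (PadicAlgCl p)ˣ)
    (U : Subgroup (PadicAlgCl p)ˣ) (hU : U.toSubmonoid ≤ O) (q : O) :
    (EtaLimSide.ofDoubleUnderline C c θ O U hU q).toEtaSteps.Containment ↔
      (EtaLimSide.ofDoubleUnderline C c θ O U hU q).toEtaSteps.Factors :=
  (EtaLimSide.ofDoubleUnderline C c θ O U hU q).containment_iff_factors_of fun _ =>
    h1LimKummer_injective_of_coeff C (phi C) (D.lDeltaTheta l) c (PiYdd C) hc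

end Model

end IUTFork

end Summit.ABC

end
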